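import Summits.QuantumFields.BalabanUV.T4Continuum.Support.NE9CurveSpeciesCouplingEnd
import Summits.QuantumFields.BalabanUV.T4Continuum.Support.NE9CurveFromBackgroundMapAdditive

/-!
# NE9CurveFromBackgroundMapEnd — the END-M read-out face FOR CURVES OF BAŁABAN'S SHAPE `σ′ ↦ Φ_X(σ′ • B)` with EVERY slice-curve
# binder PRODUCED: `CurData.Admissible`, leaf A3's (c1)–(c3) and crew row (w19)'s additivity, all from RAY-species binders on the
# shift field and the background-map TYPE facts (Φ1)–(Φ3) (cell `pub-balaban`, T4-DAG §2 node U3 ∕ §6 NE9; NE9 formalisation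
# swarm, unit `b2b-balaban-t4-ne9-formalise-leaf-06` gen 8; own-initiative micro-item «END-COMP», CLAIMS.log l.11540 — the capstone of
# leaf-05-g5's CUR-BG ∕ A3-CUR-END and this lineage's CUR-COMP-S3; at own risk)

HONEST FRAMING (T4-DAG PAGE 1).  Rung (B)+1 of the FINITE-VOLUME T⁴ programme — existence AND uniqueness of the ε → 0 limit
of gauge-invariant observables on a fixed torus; NOT infinite volume, NOT a mass gap, NOT the Clay problem.  NE9
(`T4OutputRate.NE9` ∧ `FadingMemory`) is a cell NEW ESTIMATE, NOT PRINTED, and is NOT discharged here («NE9 ⇐ the named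
binders»); spine 0∕9; 0∕18 skeleton leaves instantiated on Bałaban's objects (O-NE9-1).  HONEST DEPENDENCY (cell line,
verbatim): continuum YM on T⁴ ⇐ BetaPertH ∧ nine spine estimates (0/9 proved); BetaPertH ⇐ (D1) ∧ (D4) ∧ CAP+tail; G-an2-4
gates asym, D1 and NE2/3/4.  [I] = [Balaban1987RG1] (CMP **109**), [II] = [Balaban1988RG2Cluster] (CMP **116**) are quoted for
TYPES only (ABSOLUTE RULE: nothing printed in the audited series is asserted).  No `def`, no Prop-valued definition;
`FlowStep.BetaPertH`, (B), (B^μ) do not occur.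

WHERE THIS SITS.  The row owner's located correction O-ne9p1g25-1 (t4-ne9-p1 g25) re-typed the displayed species of [II] §1 along
analytic SLICE CURVES; leaf-05-g5's A3-CUR-END `NE9CurveSpeciesCouplingEnd.termSize_ne9_and_fadingMemory_cur_margProj_cpieceForm_A3`
(p214812) is the END-M read-out face at a GENERIC curve datum `Dc : CurData` with rows MP ∕ S-sum ∕ S5 ∕ A3 by name, displaying on
the curve side `Dc.Admissible`, (w19)'s `PieceAdditiveOn (analyticClass Dc.R) Dc.toC` and leaf A3's slice-curve binders (c1)
`hcont` ∕ (c2) `hlip` ∕ (c3) `hroom`.  For curves OF BAŁABAN'S SHAPE — leaf-05-g5's composite datum `RemData.compCur Dd Φ R′`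
(CUR-BG p215194: the ray `τ ↦ τ • B` in the shift field `B = Dd.dir … t s σ` of [II] (1.1)∕(1.23) composed with the background map
`Φ_X : B ↦ (chart of) U_j(□₀, exp iB)|_X` of [I] (3.30)∕(3.37); written `Φ` here because the face's representation functional is
`Ψ`) — every one of those curve-side binders is PRODUCED: `admissible_compCur`, `cont_compCur`, `lip_compCur`, `room_compCur`
(CUR-BG) and `pieceAdditiveOn_compCur` (this lineage's CUR-COMP-S3, p215585, through crew row (w19) p215330).  THIS FILE applies
p214812 at `Dc := Dd.compCur Φ R′` with the five producers.  DISPLAYED afterwards (honest list): O1-type data; the RAY species'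
`RemData.Admissible ℓ c_dir d₀` ([II] (1.22)–(1.25) TYPE), `0 < dirB`, (w16)'s GLOBAL `hdirC` and the global size `hdirB`
(everywhere form of `dir_le`), A3-REM's (d1) contour continuity `hcont` and (d2) coupling-Lipschitz modulus `clipd·(c_dir·ℓ·R_X)`
`hlip` (TYPE [II] (1.21)), `hhalf`, `0 ≤ clipd`, `0 < c_dir`, `0 < ℓ`; the background-map TYPE facts (Φ1) analytic on the field
ball ([I] (3.37)), (Φ2) into the chart ball of radius `R′_X` ([I] Lemma 4 (3.53)), (Φ3) `Φ_X 0 = 0` (chart normalisation); the level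
counts ON THE COMPOSITE FRAME; `Adm ⊆ analyticClass R′`, S1; RO ∕ AW ∕ `hS` and END-M's A1 ∕ A2 ∕ R ∕ G ∕ N binders VERBATIM.  GONE
vs p214812: `hD`, `hA16`, `hcont`, `hlip`, `hroom` (curve level) — replaced by ray-level + Φ-level letters.  Conclusion LITERALLY
p214812's with **`cA := 4·clipd`** (CUR-BG's Lipschitz transfer through Φ): `qTbar = (64·(4clipd)·Nbar + cr·Nbar·(64·(4clipd)·aA))
·c_Q·(1−ω)⁻¹`, `ω′ = ω + 8·lipbar·B·((1 + cr·aA)·c_Q)`.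
NET: at the END level the located correction (rays ↦ curves of Bałaban's shape) costs EXACTLY (Φ1)–(Φ3) on the background map and
the GLOBAL forms of two ray binders; no curve-level hypothesis survives.  NOT PRINTED and not claimed: that Bałaban's 𝐇_k,
U_j(□₀, exp iB), Lemma 4's U^c_j meet the ray ∕ Φ binders (O-NE9-1 ∕ O-NE9-5).  DISGUISE TEST: last coupling, one species, one
read-out dictionary; not NE9 unconditionally — «NE9 ⇐ the named binders».

WHAT IS PROVED (kernel, `[folklore]`-level bookkeeping with TYPE locators; 0 sorry, 0 def): **`termSize_ne9_and_fadingMemory_compCur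
_margProj_cpieceForm`**.

References (TYPES only): [Balaban1987RG1] T. Bałaban, CMP **109** (1987) 249–301, (0.28)–(0.30) p. 258, (1.11)–(1.14) p. 262,
(1.18) p. 263, (1.20)–(1.22) p. 264, (3.30) p. 276, (3.37) p. 277, Lemma 4 (3.53)–(3.54) p. 280; [Balaban1988RG2Cluster] T. Bałaban,
CMP **116** (1988) 1–22, (1.21)–(1.29) pp. 7–8, (1.33)–(1.36) p. 9, Lemma 3 (2.38) p. 20.  Summits-side NEW work (LEAN PLACEMENT
RULE); imports leaf-05-g5's `NE9CurveSpeciesCouplingEnd` and this lineage's `NE9CurveFromBackgroundMapAdditive` BY NAME; modifies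
nothing; ROOT ∕ END files untouched.  Value = END-face bookkeeping (binder substitution), NOT summit progress.
-/

noncomputable section

namespace Summit.QuantumFields.BalabanUV.T4Continuum.NE9CurveFromBackgroundMapEnd

open scoped BigOperators
open Metric Set
open Literature.MathematicalPhysics.QuantumFieldTheory.Balaban1983to89
open Literature.MathematicalPhysics.QuantumFieldTheory.Balaban1983to89.T4OutputRate
open Literature.MathematicalPhysics.QuantumFieldTheory.Balaban1983to89.T4HistoryLipschitzRecursion
open Literature.MathematicalPhysics.QuantumFieldTheory.Balaban1983to89.T4HistoryLipschitzOuter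
open Literature.MathematicalPhysics.QuantumFieldTheory.Balaban1983to89.T4HistoryLipschitzActivity
open Literature.MathematicalPhysics.QuantumFieldTheory.Balaban1983to89.T4HistoryLipschitzActivity (ClusterGeom)
open Literature.MathematicalPhysics.QuantumFieldTheory.Balaban1983to89.T4HistoryLipschitzSegment
open Summit.QuantumFields.BalabanUV.T4Continuum.NE9Lemma1Counting
open Summit.QuantumFields.BalabanUV.T4Continuum.NE9Lemma1Gain
open Summit.QuantumFields.BalabanUV.T4Continuum.NE9Lemma1PieceClass
open Summit.QuantumFields.BalabanUV.T4Continuum.NE9Lemma1RemainderSpecies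
open Summit.QuantumFields.BalabanUV.T4Continuum.NE9Lemma1CurveSpecies
open Summit.QuantumFields.BalabanUV.T4Continuum.NE9ComplexEncoding (doubleCarriers)
open Summit.QuantumFields.BalabanUV.T4Continuum.NE9LastCouplingBridge
open Summit.QuantumFields.BalabanUV.T4Continuum.NE9BridgeSizeInduction
open Summit.QuantumFields.BalabanUV.T4Continuum.NE9MarginalProjection
open Summit.QuantumFields.BalabanUV.T4Continuum.NE9MarginalProjectionEnd
open Summit.QuantumFields.BalabanUV.T4Continuum.NE9CurveSpeciesCouplingEnd
  (termSize_ne9_and_fadingMemory_cur_margProj_cpieceForm_A3)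
open Summit.QuantumFields.BalabanUV.T4Continuum.NE9CurveFromBackgroundMap
  (admissible_compCur cont_compCur lip_compCur room_compCur)
open Summit.QuantumFields.BalabanUV.T4Continuum.NE9CurveFromBackgroundMapAdditive (pieceAdditiveOn_compCur)

variable {C₀ : Carriers} {E : Type} [NormedAddCommGroup E] [NormedSpace ℂ E] {ι α β γ δ : Type} [DecidableEq δ]

variable (G : ClusterGeom (doubleCarriers C₀)) {Pot : Type*} [NormedAddCommGroup Pot] [NormedSpace ℂ Pot]

/-- **NE9 ∧ FADING MEMORY ∧ TERM SIZE ON THE v1.3 DICTIONARY FOR CURVES OF BAŁABAN'S SHAPE, EVERY SLICE-CURVE BINDER PRODUCED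
(kernel end-to-end).**  leaf-05-g5's A3-CUR-END `termSize_ne9_and_fadingMemory_cur_margProj_cpieceForm_A3` (p214812) APPLIED at
the composite curve datum `Dc := Dd.compCur Φ R′` (slice curve `τ ↦ Φ_X(τ • Dd.dir … t s σ)`, slice radius `R_X∕dirB`, chart
radii `R′`) with its FIVE curve-side binders PRODUCED by name: `hD := admissible_compCur hDd hpos hΦan hΦmaps`; (w19)'s `hA16 :=
NE9CurveFromBackgroundMapAdditive.pieceAdditiveOn_compCur hDd hpos hdirC hdirB hΦan hΦmaps`; (c1) `hcont := cont_compCur hDd hΦan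
hcont`; (c2) `hlip := lip_compCur hDd hΦan hΦmaps hclipd hcdir hℓpos hlip` (so **`cA := 4·clipd`**); (c3) `hroom := room_compCur hDd
hΦan hΦmaps hΦ0 hcdir hℓpos W` (Schwarz).  DISPLAYED (honest list): the RAY species' `Dd.Admissible ℓ c_dir d₀`, `0 < dirB`,
(w16)'s GLOBAL `hdirC`, the global size `hdirB` (everywhere form of `dir_le`), A3-REM's (d1) `hcont` ∕ (d2) `hlip` (modulus
`clipd·(c_dir·ℓ k j·R_X)`), `hhalf`, `0 ≤ clipd`, `0 < c_dir`, `0 < ℓ` — TYPE [II] (1.21)–(1.25) p. 7; the background-map TYPE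
facts (Φ1) `Φ_X` analytic on `ball 0 (R_X)` ([I] (3.37) p. 277), (Φ2) `MapsTo (Φ X) (ball 0 R_X) (ball 0 R′_X)` ([I] Lemma 4 (3.53)
p. 280), (Φ3) `Φ_X 0 = 0`; the level counts on the composite frame ((1.26)–(1.28)); `Adm ⊆ analyticClass R′` and S1; AW
(`DirSize A κ aA`, `A ∈ analyticClass R′`, `hAmul`); RO (`hrA hr0 hrs hcr`, `hcoef`, `hnorm`) and `hS`; `N j ≤ Nbar`; END-M's A1 ∕
A2 ∕ R ∕ G ∕ N binders VERBATIM at `T := cpieceChannel (Dd.compCur Φ R′).toC ∘ margProj r A`.  GONE vs p214812: `hD`, `hA16`,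
`hcont`∕`hlip`∕`hroom` at curve level.  Conclusion = p214812's with `cA := 4·clipd`.  Nothing of [I]–[II] asserted; that Bałaban's
𝐇_k, U_j(□₀, exp iB) and U^c_j meet the ray ∕ Φ binders is O-NE9-1 ∕ O-NE9-5, NOT claimed; NE9 NOT PROVED; 0/9 unchanged.
[cite: Balaban1987RG1, (0.28)-(0.30) p.258, (1.11)-(1.14) p.262, (1.18) p.263, (3.37) p.277, (3.53)-(3.54) p.280; Balaban1988RG2Cluster, (1.21)-(1.29) pp.7-8, (1.33)-(1.36) p.9, Lemma 3 (2.38) p.20] -/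
theorem termSize_ne9_and_fadingMemory_compCur_margProj_cpieceForm
    {Dd : RemData C₀ E ι α β γ δ} {ℓg : ℕ → ℕ → ℝ} {cdir d0 : ℝ} {Φ : C₀.Dom → E → E} {R' : C₀.Dom → ℝ}
    {Ef : Functional (doubleCarriers C₀) E} {W : Set (ℕ → ℝ)} {Adm S : Set (E → (doubleCarriers C₀).Dom → ℝ)}
    {r : ℕ → (E → (doubleCarriers C₀).Dom → ℝ) → ℝ} {A : E → (doubleCarriers C₀).Dom → ℝ}
    {Ψ : ℕ → ℝ → (ι → ℝ) → E → (doubleCarriers C₀).Dom → ℝ} {act : ℕ → ℝ → E → Pot → G.P → ℂ} {𝒜 : ℕ → Set Pot}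
    {n : ℕ → ℝ → E → G.P → ℝ} {lip clip : ℕ → ℝ} {a d : G.P → ℝ} {δv : (doubleCarriers C₀).Dom → ℝ}
    {κ O1 cQ ω clipd Nbar B lipbar clipbar cr aA : ℝ} {p₀ N : ℕ → ℝ}
    (ρ : ℕ → (ι → ℝ) → Pot) (U₀ : E) (explZ : ℕ → E → (doubleCarriers C₀).Dom → ℝ) (h0 : ScaleZeroFree Ef W)
    (hAdm : AdmissibleTerms Ef W Adm) (hres : AdmRestrict Adm)
    -- the RAY species' binders on the shift field (printed TYPE + numerals), the GLOBAL ray pair and `0 < dirB`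
    (hDd : Dd.Admissible ℓg cdir d0) (hpos : ∀ k s y a' b x, 0 < Dd.dirB k s y a' b x)
    (hdirC : ∀ k s y a' b x, Continuous fun p : ℂ × (δ → ℝ) × (δ → ℂ) => Dd.dir k s y a' b x p.1 p.2.1 p.2.2)
    (hdirB : ∀ k s y a' b x t s' σ', ‖Dd.dir k s y a' b x t s' σ'‖ ≤ Dd.dirB k s y a' b x)
    -- the background-map TYPE facts (Φ1)–(Φ3)
    (hΦan : ∀ X, DifferentiableOn ℂ (Φ X) (ball 0 (Dd.R X))) (hΦmaps : ∀ X, MapsTo (Φ X) (ball 0 (Dd.R X)) (ball 0 (R' X)))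
    (hΦ0 : ∀ X, Φ X 0 = 0)
    -- the level counts on the composite frame and the analyticity of the admissible terms (chart radii R′)
    (hL : LevelCountsG (Dd.compCur Φ R').toC.frame κ (Dd.compCur Φ R').κ₁ O1 cQ (fun k j => ℓg k j ^ 5) (agePow ω))
    (hAdmAn : Adm ⊆ analyticClass (Dd.compCur Φ R').R)
    -- the read-out and the marginal direction (END-M's RO / AW binders, verbatim) …
    (hrA : ReadAdditive Adm r) (hr0 : ReadZero r) (hrs : ReadSize Adm r κ cr) (hA : DirSize A κ aA) (hcr : 0 ≤ cr)
    (haA : 0 ≤ aA)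
    -- … and what MP needs of them at the species ((w21)-MP, verbatim)
    (hAan : A ∈ analyticClass (Dd.compCur Φ R').R)
    (hAmul : ∀ c : ℕ → ℝ, (fun U X' => c ((doubleCarriers C₀).scale X') * A U X') ∈ Adm)
    (hcoef : ∀ (j : ℕ) (c : ℝ), r j (restrictScale j (c • A)) = c * r j (restrictScale j A))
    (hnorm : ∀ j : ℕ, r j (restrictScale j A) = 1 ∨ ∀ H ∈ Adm, r j (restrictScale j H) = 0)
    (hS : ∀ H ∈ Adm, margProj r A H ∈ S)
    -- leaf A3 at RAY level: A3-REM's (d1) contour continuity, (d2) coupling-Lipschitz modulus of the shift-field directions, scalars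
    (hclipd : 0 ≤ clipd) (hcdir : 0 < cdir) (hℓpos : ∀ k j, 0 < ℓg k j) (hhalf : ∀ k j, cdir * ℓg k j < 1 / 2)
    (hcont : ∀ (k : ℕ) (s : ℕ → ℝ) (y : ι) (a' : α) (b : β) (x : (doubleCarriers C₀).Dom),
      ContinuousOn (fun p : ℂ × ((δ → ℝ) × (δ → ℂ)) => Dd.dir k s y a' b x p.1 p.2.1 p.2.2)
        (sphere (0:ℂ) (Dd.r k) ×ˢ {q | OnContour Dd.κ₁ (Dd.cubes k y a' b) q.1 q.2}))
    (hlip : ∀ g ∈ W, ∀ g' ∈ W, ∀ (k : ℕ) (y : ι), ∀ a' ∈ Dd.S0 k y, ∀ b ∈ Dd.SY k y a', ∀ (j : ℕ), ∀ x ∈ Dd.src k y a' j,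
      ∀ t ∈ sphere (0:ℂ) (Dd.r k), ∀ (s' : δ → ℝ) (σ' : δ → ℂ), OnContour Dd.κ₁ (Dd.cubes k y a' b) s' σ' →
        ‖Dd.dir k g y a' b x t s' σ' - Dd.dir k g' y a' b x t s' σ'‖ ≤ clipd * (cdir * ℓg k j * Dd.R x.1) * |g k - g' k|)
    (hO1 : 0 ≤ O1) (hcQ : 0 ≤ cQ) (hω0 : 0 ≤ ω) (hω1 : ω < 1) (hNb : ∀ j, N j ≤ Nbar)
    -- END-M's remaining binders at `T := cpieceChannel (Dd.compCur Φ R').toC ∘ margProj r A`, verbatim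
    (hfac : Factorises Ef W (compProj (cpieceChannel (Dd.compCur Φ R').toC) (margProj r A)) Ψ) (hclip0 : ∀ k, 0 ≤ clip k)
    (hCup : ∀ g ∈ W, ∀ g' ∈ W, ∀ (k : ℕ) (U : E) (X : (doubleCarriers C₀).Dom), (doubleCarriers C₀).scale X = k + 1 →
      ∀ Q ∈ 𝒜 k, ∀ γ' ∈ G.vol X,
      ‖act k (g k) U Q γ'‖ ≤ n k (g' k) U γ' ∧
        ‖act k (g k) U Q γ' - act k (g' k) U Q γ'‖ ≤ clip k * |g k - g' k| * n k (g' k) U γ')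
    (hreprV : ∀ (k : ℕ) (s : ℝ) (Q : ι → ℝ) (U : E) (X : (doubleCarriers C₀).Dom),
      Ψ k s Q U X = (G.newTerm act k s U X (ρ k Q)).re - (G.newTerm act k s U₀ X (ρ k Q)).re + explZ k U X)
    (hclipb : ∀ k, clip k ≤ clipbar)
    (hK : TwoPointKP G W act 𝒜 n lip a d) (hdec : G.DecayExtract δv d) (hpin : G.PinBudget a δv (fun _ => B) κ)
    (hρ : ∀ (k : ℕ) (Q Q' : ι → ℝ) (M : ℝ),
      (∀ y, |Q y - Q' y| ≤ weightOf (Dd.compCur Φ R').toC.frame (Dd.compCur Φ R').κ₁ d0 O1 ((Dd.compCur Φ R').Kp cdir) k y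
        * M) → ‖ρ k Q - ρ k Q'‖ ≤ M)
    (hexplZ : ∀ (k : ℕ) (U : E) (X : (doubleCarriers C₀).Dom), (doubleCarriers C₀).scale X = k + 1 →
      |explZ k U X| ≤ Real.exp (-(κ * (doubleCarriers C₀).d X)) * p₀ k)
    (hbase : ∀ g ∈ W, ∀ (U : E) (X : (doubleCarriers C₀).Dom), (doubleCarriers C₀).scale X = 0 →
      |Ef g U X| ≤ Real.exp (-(κ * (doubleCarriers C₀).d X)) * N 0)
    (hNsucc : ∀ j, p₀ j + 2 * B ≤ N (j + 1)) (hNnn : ∀ j, 0 ≤ N j)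
    (hbox : ∀ (k : ℕ) (Q : ι → ℝ),
      (∀ y, |Q y| ≤ weightOf (Dd.compCur Φ R').toC.frame (Dd.compCur Φ R').κ₁ d0 O1 ((Dd.compCur Φ R').Kp cdir) k y *
        sizeRadius (fun k j => (1 + cr * aA) * tauOfG cQ (agePow ω) k j) N k) → ρ k Q ∈ 𝒜 k)
    (hB : 0 ≤ B) (hlipb : ∀ k, lip k ≤ lipbar) (hpos' : 0 < ω + 8 * lipbar * B * ((1 + cr * aA) * cQ)) :
    TermSize Ef W κ N ∧
      NE9 Ef W κ (prodModuli (8 * clipbar * B + 8 * lipbar * B *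
          ((64 * (4 * clipd) * Nbar + cr * Nbar * (64 * (4 * clipd) * aA)) * cQ * (1 - ω)⁻¹))
        fun _ => ω + 8 * lipbar * B * ((1 + cr * aA) * cQ)) ∧
        FadingMemory ((8 * clipbar * B + 8 * lipbar * B *
              ((64 * (4 * clipd) * Nbar + cr * Nbar * (64 * (4 * clipd) * aA)) * cQ * (1 - ω)⁻¹)) /
            (ω + 8 * lipbar * B * ((1 + cr * aA) * cQ)))
          (ω + 8 * lipbar * B * ((1 + cr * aA) * cQ))
          (prodModuli (8 * clipbar * B + 8 * lipbar * B *
              ((64 * (4 * clipd) * Nbar + cr * Nbar * (64 * (4 * clipd) * aA)) * cQ * (1 - ω)⁻¹))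
            fun _ => ω + 8 * lipbar * B * ((1 + cr * aA) * cQ)) :=
  termSize_ne9_and_fadingMemory_cur_margProj_cpieceForm_A3 G ρ U₀ explZ h0 hAdm hres
    (admissible_compCur hDd hpos hΦan hΦmaps) hL hAdmAn (pieceAdditiveOn_compCur hDd hpos hdirC hdirB hΦan hΦmaps)
    hrA hr0 hrs hA hcr haA hAan hAmul hcoef hnorm hS (by positivity) hcdir hℓpos hhalf (cont_compCur hDd hΦan hcont)
    (lip_compCur hDd hΦan hΦmaps hclipd hcdir hℓpos hlip) (room_compCur hDd hΦan hΦmaps hΦ0 hcdir hℓpos W) hO1 hcQ hω0 hω1 hNb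
    hfac hclip0 hCup hreprV hclipb hK hdec hpin hρ hexplZ hbase hNsucc hNnn hbox hB hlipb hpos'

end Summit.QuantumFields.BalabanUV.T4Continuum.NE9CurveFromBackgroundMapEnd

end
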